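import Summits.KontsevichZagierPeriods.KontsevichZagierPeriods.Theorems.AbelContractionRealHyperellipticSectorStubEulerMoves

/-!
# Route AbelContraction — `RealHyperellipticSector` (crux stmt-KontsevichZagierPeriods-12475): the Euler stub

Pure proof file of the line `Lines/birth.lean` (registered stub `stub_euler`, `--supports` the
crux). **Euler's substitutions inside dimension one**: for `q ∈ ℚ[X]` with `deg q ≤ 2`, every
element of the subgroup of `KZ.FormalRep` generated by the ARC generators `[S, (A + B√q)/D]` of the
sector of `q` (`S ⊆ {q > 0, D ≠ 0}` an open interval, `A B D ∈ ℚ[X]`) and the constants is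
congruent modulo the truncated relations `KZ.relationsLE 1` to an element of the subgroup
generated by the real-algebraic rational arcs `algArcs` (`[T, P/Q]`, `P, Q ∈ K[X]`, `K` the real
algebraic numbers) and the constants.

Proof (`Euler.exists_algArc_of_mem_arcs`, one arc at a time; then
`closure (arcs q ∪ consts) ≤ closure (algArcs ∪ consts) ⊔ relationsLE 1` generator by generator).
Write `q = a x² + b x + c` (`Euler.aeval_eq_quadratic`). NO MOVE is needed when `√q` is affine
with real algebraic coefficients on the arc (`Euler.of_mem_algArcs_of_sqrt_affine`): the empty
arc, `a = b = 0` (`√q = √c`), and a double root `e` (`b² = 4ac`, then `a > 0` and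
`√q = √a |x − e| = ±√a (x − e)` on the interval `S ∌ e`). Otherwise exactly ONE move of rule (2)
(`Euler.exists_algArc_of_subst`): `t = √q` for `a = 0 ≠ b` (`Euler.euler_linear`:
`x = (t² − c)/b`, `dx = 2t dt/b`), Euler's third substitution for `b² > 4ac`
(`Euler.euler_twoRoots`, roots `(−b ∓ √Δ)/(2a)`), Euler's first substitution for `b² < 4ac`
(`Euler.euler_noRoot`; `a > 0` is forced by `4a·q = (2ax + b)² + (4ac − b²)` at a point of the
arc).

References: M. Kontsevich, D. Zagier, *Periods* (2001), §1.2 rule (2) [KontsevichZagier2001];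
L. Euler, *Institutiones calculi integralis* I (1768) (Euler's substitutions; folklore). No
definitions are introduced.
-/

noncomputable section

open Set MeasureTheory
open scoped Polynomial
open Literature.ModelTheory.ExponentialFields (IsSemialgebraic)
open Literature.NumberTheory.Transcendental Literature.NumberTheory.Transcendental.KZ

namespace Summit.KontsevichZagierPeriods.AbelContraction.RealHyperellipticSector

namespace Euler

/-! ## Euler's substitution for `deg q = 1`: `t = √q` -/

/-- **Euler's substitution, linear radicand.** For an arc `[S, (A + B√q)/D]` with `q = b x + c`,
`b ≠ 0`, the substitution `t = √(q(x))` (inverse `x = (t² − c)/b`, `dx = (2t/b) dt`) is one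
rule-(2) move to the real-algebraic (indeed rational) arc
`[√q(S), (A((t²−c)/b) + B((t²−c)/b)·t)/D((t²−c)/b) · 2t/|b|]`.
[cite: KontsevichZagier2001, §1.2 rule (2)] -/
theorem euler_linear (r : IntegralRep 1) (A B D : ℚ[X]) {S : Set ℝ} (hS : IsOpen S)
    (hSo : S.OrdConnected) (hdom : r.domain = {p | p 0 ∈ S}) (q : ℝ → ℝ) {b c : ℝ}
    (hb : IsAlgebraic ℚ b) (hc : IsAlgebraic ℚ c) (hb0 : b ≠ 0) (hq : ∀ x, q x = b * x + c)
    (hpos : ∀ x ∈ S, 0 < q x) (hD : ∀ x ∈ S, (Polynomial.aeval x D : ℝ) ≠ 0)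
    (hint : ∀ p ∈ r.domain, r.integrand p = (Polynomial.aeval (p 0) A +
      Polynomial.aeval (p 0) B * √(q (p 0))) / Polynomial.aeval (p 0) D) :
    ∃ x' ∈ algArcs, of r - x' ∈ relationsLE 1 := by
  have hmem : ∀ p, p ∈ r.domain ↔ p 0 ∈ S := fun p => by rw [hdom]; rfl
  have hσ := r.isSemialgebraic_domain
  have hsq : ∀ x ∈ S, 0 < √(q x) := fun x hx => Real.sqrt_pos.mpr (hpos x hx)
  -- semialgebraicity of `φ = √q` and `φ' = b/(2√q)` on the slab
  have hx0 : IsSemialgebraicFunOn ℚ r.domain (fun p : Fin 1 → ℝ => p 0) := by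
    simpa using isSemialgebraicFunOn_aeval hσ (MvPolynomial.X 0 : MvPolynomial (Fin 1) ℚ)
  have h2A : IsAlgebraic ℚ (2 : ℝ) := by simpa using isAlgebraic_nat (R := ℚ) (A := ℝ) 2
  have habsA : ∀ {y : ℝ}, IsAlgebraic ℚ y → IsAlgebraic ℚ |y| := fun {y} hy => by
    rcases abs_choice y with h | h <;> rw [h]
    exacts [hy, hy.neg]
  have hqsa : IsSemialgebraicFunOn ℚ r.domain (fun p => q (p 0)) :=
    (((isSemialgebraicFunOn_const_of_isAlgebraic hσ hb).fun_mul hx0).fun_add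
      (isSemialgebraicFunOn_const_of_isAlgebraic hσ hc)).congr fun p _ => (hq (p 0)).symm
  have hφ : IsSemialgebraicFunOn ℚ r.domain (fun p => √(q (p 0))) := hqsa.fun_sqrt
  have hφ' : IsSemialgebraicFunOn ℚ r.domain (fun p => b / (2 * √(q (p 0)))) :=
    (isSemialgebraicFunOn_const_of_isAlgebraic hσ hb).div
      ((isSemialgebraicFunOn_const_ofNat hσ 2).fun_mul hφ)
      fun p hp => mul_ne_zero two_ne_zero (hsq _ ((hmem p).1 hp)).ne'
  -- the derivative
  have hq' : ∀ x, HasDerivAt q b x := fun x => by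
    have e : q = fun y => b * y + c := funext hq
    rw [e]
    exact (((hasDerivAt_id' x).const_mul b).add_const c).congr_deriv (mul_one b)
  have hder : ∀ x ∈ S, HasDerivAt (fun y => √(q y)) (b / (2 * √(q x))) x := fun x hx =>
    (hq' x).sqrt (hpos x hx).ne'
  have hne : ∀ x ∈ S, b / (2 * √(q x)) ≠ 0 := fun x hx =>
    div_ne_zero hb0 (mul_ne_zero two_ne_zero (hsq x hx).ne')
  -- the inverse `ψ t = (t² − c)/b`
  have hψφ : ∀ x ∈ S, (√(q x) ^ 2 - c) / b = x := fun x hx => by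
    rw [Real.sq_sqrt (hpos x hx).le, hq, div_eq_iff hb0]
    ring
  have hψ : ∃ P Q : (algebraicClosure ℚ ℝ)[X], ∀ t ∈ (fun y => √(q y)) '' S,
      (Polynomial.aeval t Q : ℝ) ≠ 0 ∧
      (fun t : ℝ => (t ^ 2 - c) / b) t = (Polynomial.aeval t P : ℝ) / (Polynomial.aeval t Q : ℝ) :=
    krat_div (krat_sub (krat_pow (krat_id _) 2) (krat_const _ hc)) (krat_const _ hb)
      fun _ _ => hb0
  -- the pushed-forward integrand
  have hDT : ∀ t ∈ (fun y => √(q y)) '' S,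
      (Polynomial.aeval ((fun t : ℝ => (t ^ 2 - c) / b) t) D : ℝ) ≠ 0 := by
    rintro _ ⟨x, hx, rfl⟩
    beta_reduce
    rw [hψφ x hx]
    exact hD x hx
  have hF : ∃ P Q : (algebraicClosure ℚ ℝ)[X], ∀ t ∈ (fun y => √(q y)) '' S,
      (Polynomial.aeval t Q : ℝ) ≠ 0 ∧
      (fun t : ℝ => (Polynomial.aeval ((t ^ 2 - c) / b) A +
            Polynomial.aeval ((t ^ 2 - c) / b) B * t) /
          Polynomial.aeval ((t ^ 2 - c) / b) D * (2 * t / |b|)) t =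
        (Polynomial.aeval t P : ℝ) / (Polynomial.aeval t Q : ℝ) :=
    krat_mul (krat_div (krat_add (krat_aeval A hψ) (krat_mul (krat_aeval B hψ) (krat_id _)))
      (krat_aeval D hψ) hDT)
      (krat_div (krat_mul (krat_const _ h2A) (krat_id _))
        (krat_const _ (habsA hb)) fun _ _ => abs_ne_zero.mpr hb0)
  refine exists_algArc_of_subst r S hS hSo hdom (fun y => √(q y)) (fun x => b / (2 * √(q x)))
    (fun t => (t ^ 2 - c) / b)
    (fun t => (Polynomial.aeval ((t ^ 2 - c) / b) A + Polynomial.aeval ((t ^ 2 - c) / b) B * t) /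
      Polynomial.aeval ((t ^ 2 - c) / b) D * (2 * t / |b|))
    hφ hφ' hder hne hψ hψφ (by exact_mod_cast hF) fun p hp => ?_
  -- the Jacobian identity on the slab
  have hx := (hmem p).1 hp
  have h1 := hsq _ hx
  have h2 := hD _ hx
  rw [hint p hp]
  show _ = (Polynomial.aeval ((√(q (p 0)) ^ 2 - c) / b) A +
      Polynomial.aeval ((√(q (p 0)) ^ 2 - c) / b) B * √(q (p 0))) /
    Polynomial.aeval ((√(q (p 0)) ^ 2 - c) / b) D * (2 * √(q (p 0)) / |b|)
  rw [hψφ _ hx, abs_div, abs_of_pos (mul_pos two_pos h1)]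
  field_simp

/-! ## The cases without a move, and the case analysis on `q` -/

/-- A polynomial of degree `≤ 2` is the quadratic `a x² + b x + c` of its coefficients.
[folklore] -/
theorem aeval_eq_quadratic {q : ℚ[X]} (hq : q.natDegree ≤ 2) (x : ℝ) :
    (Polynomial.aeval x q : ℝ) =
      (q.coeff 2 : ℝ) * x ^ 2 + (q.coeff 1 : ℝ) * x + (q.coeff 0 : ℝ) := by
  rw [Polynomial.aeval_eq_sum_range' (Nat.lt_succ_of_le hq), Finset.sum_range_succ,
    Finset.sum_range_succ, Finset.sum_range_one]
  simp only [Algebra.smul_def, eq_ratCast, pow_zero, mul_one, pow_one]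
  ring

/-- **No move needed**: if on the arc `√q` is an affine function `κ + μ x` with real algebraic
`κ, μ` (constant radicand, a double root, or an empty arc), the arc `[S, (A + B√q)/D]` is itself a
real-algebraic rational arc. [cite: KontsevichZagier2001, §1.1] -/
theorem of_mem_algArcs_of_sqrt_affine (r : IntegralRep 1) (A B D : ℚ[X]) {S : Set ℝ}
    (hS : IsOpen S) (hSo : S.OrdConnected) (hdom : r.domain = {p | p 0 ∈ S}) (q : ℝ → ℝ)
    {κ μ : ℝ} (hκ : IsAlgebraic ℚ κ) (hμ : IsAlgebraic ℚ μ) (hsqrt : ∀ x ∈ S, √(q x) = κ + μ * x)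
    (hD : ∀ x ∈ S, (Polynomial.aeval x D : ℝ) ≠ 0)
    (hint : ∀ p ∈ r.domain, r.integrand p = (Polynomial.aeval (p 0) A +
      Polynomial.aeval (p 0) B * √(q (p 0))) / Polynomial.aeval (p 0) D) : of r ∈ algArcs := by
  have hmem : ∀ p, p ∈ r.domain ↔ p 0 ∈ S := fun p => by rw [hdom]; rfl
  refine of_mem_algArcs r S hS hSo hdom
    (fun x => (Polynomial.aeval x A + Polynomial.aeval x B * (κ + μ * x)) / Polynomial.aeval x D)
    (krat_div (krat_add (krat_aeval A (krat_id S)) (krat_mul (krat_aeval B (krat_id S))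
      (krat_add (krat_const S hκ) (krat_mul (krat_const S hμ) (krat_id S)))))
      (krat_aeval D (krat_id S)) hD) fun p hp => ?_
  rw [hint p hp, hsqrt _ ((hmem p).1 hp)]

/-- **Euler's substitutions, one arc.** For `deg q ≤ 2` every arc generator `[S, (A + B√q)/D]` of
the sector of `q` is congruent modulo `KZ.relationsLE 1` to a real-algebraic rational arc: no move
if the arc is empty, `q` is constant or `q` has a double root (`√q` is then affine with real
algebraic coefficients on the arc), and otherwise exactly one rule-(2) move — `t = √q` for
`deg q = 1`, Euler's third substitution `t = √q/(x − e)` for two simple real roots, Euler's first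
substitution `t = √q + √a x` for no real root. [cite: KontsevichZagier2001, §1.2 rule (2)] -/
theorem exists_algArc_of_mem_arcs {q : ℚ[X]} (hq : q.natDegree ≤ 2) {y : FormalRep}
    (hy : y ∈ arcs q) : ∃ x' ∈ algArcs, y - x' ∈ relationsLE 1 := by
  obtain ⟨r, A, B, D, S, hS, hSo, hdom, hposD, hint, rfl⟩ := hy
  have hmem : ∀ p, p ∈ r.domain ↔ p 0 ∈ S := fun p => by rw [hdom]; rfl
  -- the data read on `S`
  have hpos : ∀ x ∈ S, 0 < (Polynomial.aeval x q : ℝ) := fun x hx =>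
    (hposD (fun _ => x) ((hmem _).2 hx)).1
  have hD : ∀ x ∈ S, (Polynomial.aeval x D : ℝ) ≠ 0 := fun x hx =>
    (hposD (fun _ => x) ((hmem _).2 hx)).2
  have hint' : ∀ p ∈ r.domain, r.integrand p = (Polynomial.aeval (p 0) A +
      Polynomial.aeval (p 0) B * √((fun x => (Polynomial.aeval x q : ℝ)) (p 0))) /
        Polynomial.aeval (p 0) D := fun p hp => hint hp
  -- no move: it suffices that `√q` be affine with algebraic coefficients on `S`
  have affine : ∀ κ μ : ℝ, IsAlgebraic ℚ κ → IsAlgebraic ℚ μ →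
      (∀ x ∈ S, √(Polynomial.aeval x q : ℝ) = κ + μ * x) →
      ∃ x' ∈ algArcs, of r - x' ∈ relationsLE 1 := fun κ μ hκ hμ hsqrt =>
    ⟨of r, of_mem_algArcs_of_sqrt_affine r A B D hS hSo hdom (fun x => (Polynomial.aeval x q : ℝ))
      hκ hμ hsqrt hD hint', by rw [sub_self]; exact zero_mem _⟩
  -- the quadratic
  set a : ℚ := q.coeff 2 with ha_def
  set b : ℚ := q.coeff 1 with hb_def
  set c : ℚ := q.coeff 0 with hc_def
  have hq3 : ∀ x : ℝ, (Polynomial.aeval x q : ℝ) = (a : ℝ) * x ^ 2 + (b : ℝ) * x + (c : ℝ) :=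
    aeval_eq_quadratic hq
  have haA : IsAlgebraic ℚ (a : ℝ) := isAlgebraic_algebraMap a
  have hbA : IsAlgebraic ℚ (b : ℝ) := isAlgebraic_algebraMap b
  have hcA : IsAlgebraic ℚ (c : ℝ) := isAlgebraic_algebraMap c
  have h2A : IsAlgebraic ℚ (2 : ℝ) := by simpa using isAlgebraic_nat (R := ℚ) (A := ℝ) 2
  rcases S.eq_empty_or_nonempty with hSe | ⟨x₀, hx₀⟩
  · -- empty arc
    exact affine 0 0 isAlgebraic_zero isAlgebraic_zero fun x hx => by
      rw [hSe] at hx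
      exact hx.elim
  by_cases ha : (a : ℝ) = 0
  · by_cases hb : (b : ℝ) = 0
    · -- constant radicand
      refine affine (√(c : ℝ)) 0 (isAlgebraic_sqrt hcA) isAlgebraic_zero fun x _ => ?_
      rw [hq3, ha, hb]
      simp
    · -- linear radicand: `t = √q`
      exact euler_linear r A B D hS hSo hdom (fun x => (Polynomial.aeval x q : ℝ)) hbA hcA hb
        (fun x => by rw [hq3, ha]; ring) hpos hD hint'
  -- `deg q = 2`: sign of the discriminant
  have hq0 := hpos x₀ hx₀
  rcases lt_trichotomy ((b : ℝ) ^ 2) (4 * a * c) with hΔ | hΔ | hΔ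
  · -- no real root: `a > 0` and Euler's first substitution
    have ha0 : 0 < (a : ℝ) := by
      have h4 : 0 < 4 * (a : ℝ) * Polynomial.aeval x₀ q := by
        rw [hq3]
        nlinarith [sq_nonneg (2 * (a : ℝ) * x₀ + b)]
      nlinarith [h4, hq0]
    exact euler_noRoot r A B D S hS hSo hdom (fun x => (Polynomial.aeval x q : ℝ)) a b c haA hbA
      hcA ha0 hΔ hq3 hpos hD hint'
  · -- a double root `e = −b/(2a)`: `√q = √a |x − e|` is affine on the arc, no move
    set e : ℝ := -(b : ℝ) / (2 * a) with he_def
    have hqe : ∀ x : ℝ, (Polynomial.aeval x q : ℝ) = a * (x - e) ^ 2 := fun x => by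
      rw [hq3, he_def]
      field_simp
      linear_combination -hΔ
    have ha0 : 0 < (a : ℝ) := by
      rw [hqe] at hq0
      exact pos_of_mul_pos_left hq0 (sq_nonneg _)
    have heS : e ∉ S := fun h => by
      have := hpos e h
      rw [hqe, sub_self] at this
      simp at this
    obtain ⟨sgn, hsgn, habs⟩ := exists_sign_of_notMem hSo heS
    have hsgnA : IsAlgebraic ℚ sgn := by
      rcases hsgn with rfl | rfl
      exacts [isAlgebraic_one, isAlgebraic_one.neg]
    have heA : IsAlgebraic ℚ e := (hbA.neg).mul ((h2A.mul haA).inv)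
    have hρA : IsAlgebraic ℚ (√(a : ℝ)) := isAlgebraic_sqrt haA
    refine affine (-(√(a : ℝ) * sgn * e)) (√(a : ℝ) * sgn) ((hρA.mul hsgnA).mul heA).neg
      (hρA.mul hsgnA) fun x hx => ?_
    rw [hqe, Real.sqrt_mul' _ (sq_nonneg _), Real.sqrt_sq_eq_abs, habs x hx]
    ring
  · -- two simple real roots: Euler's third substitution
    set Δ : ℝ := (b : ℝ) ^ 2 - 4 * a * c with hΔ_def
    have hΔ0 : 0 < Δ := by rw [hΔ_def]; linarith
    have hsΔ : √Δ * √Δ = Δ := Real.mul_self_sqrt hΔ0.le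
    have hsΔ0 : 0 < √Δ := Real.sqrt_pos.mpr hΔ0
    set e : ℝ := (-(b : ℝ) - √Δ) / (2 * a) with he_def
    set e' : ℝ := (-(b : ℝ) + √Δ) / (2 * a) with he'_def
    have hΔA : IsAlgebraic ℚ (√Δ) :=
      isAlgebraic_sqrt ((hbA.pow 2).sub (((isAlgebraic_nat 4).mul haA).mul hcA))
    have h2a : IsAlgebraic ℚ ((2 * (a : ℝ))⁻¹) := (h2A.mul haA).inv
    have heA : IsAlgebraic ℚ e := (hbA.neg.sub hΔA).mul h2a
    have he'A : IsAlgebraic ℚ e' := (hbA.neg.add hΔA).mul h2a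
    have hee' : e ≠ e' := by
      rw [he_def, he'_def]
      intro h
      rw [div_eq_div_iff (mul_ne_zero two_ne_zero ha) (mul_ne_zero two_ne_zero ha)] at h
      have : √Δ * (2 * a) = 0 := by linear_combination -h / 2
      simp only [mul_eq_zero] at this
      rcases this with h' | h' | h'
      · exact hsΔ0.ne' h'
      · norm_num at h'
      · exact ha h'
    have hqf : ∀ x : ℝ, (Polynomial.aeval x q : ℝ) = a * (x - e) * (x - e') := fun x => by
      rw [hq3, he_def, he'_def]
      field_simp
      linear_combination hsΔ
    exact euler_twoRoots r A B D hS hSo hdom (fun x => (Polynomial.aeval x q : ℝ)) haA heA he'A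
      ha hee' hqf hpos hD hint'

end Euler

/-- **Stub `stub_euler` (Euler's substitutions inside dimension one)** of the line
`Lines/birth.lean` of crux stmt-KontsevichZagierPeriods-12475: for `deg q ≤ 2`, every element of
the subgroup generated by the arc generators `[S, (A + B√q)/D]` of the sector of `q` and the
constants is congruent modulo `KZ.relationsLE 1` to an element of the subgroup generated by the
real-algebraic rational arcs `[T, P/Q]` (`P, Q ∈ K[X]`, `K` the real algebraic numbers) and the
constants: each arc is carried to such an arc by at most ONE rule-(2) move (genus-`0`
rationalisation `Euler.exists_algArc_of_mem_arcs`), and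
`closure (arcs q ∪ consts) ≤ closure (algArcs ∪ consts) ⊔ relationsLE 1` follows generator by
generator. [cite: KontsevichZagier2001, §1.2 rule (2)] -/
theorem stub_euler : ∀ (q : Polynomial ℚ), q.natDegree ≤ 2 → ∀ x ∈ AddSubgroup.closure (arcs q ∪ consts), ∃ x' ∈ AddSubgroup.closure (algArcs ∪ consts), x - x' ∈ KZ.relationsLE 1 := by
  intro q hq x hx
  have hle : AddSubgroup.closure (arcs q ∪ consts) ≤
      AddSubgroup.closure (algArcs ∪ consts) ⊔ KZ.relationsLE 1 := by
    rw [AddSubgroup.closure_le]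
    rintro y (hy | hy)
    · obtain ⟨x', hx', hrel⟩ := Euler.exists_algArc_of_mem_arcs hq hy
      have e : y = x' + (y - x') := by abel
      rw [e]
      exact AddSubgroup.add_mem _
        (AddSubgroup.mem_sup_left (AddSubgroup.subset_closure (Or.inl hx')))
        (AddSubgroup.mem_sup_right hrel)
    · exact AddSubgroup.mem_sup_left (AddSubgroup.subset_closure (Or.inr hy))
  obtain ⟨g, hg, w, hw, hgw⟩ := AddSubgroup.mem_sup.mp (hle hx)
  refine ⟨g, hg, ?_⟩
  rwa [← hgw, add_sub_cancel_left]

end Summit.KontsevichZagierPeriods.AbelContraction.RealHyperellipticSector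

end
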